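import Mathlib.NumberTheory.ModularForms.LevelOne.Basic
import Literature.NumberTheory.Automorphic.ModularLambdaNome
import HarnessLib

/-!
# `dλ/dτ = πi · λ · θ₄⁴`: the modular `λ`-function has no critical points

Seventh file on the modular `λ`-function (`ModularLambda.lean`: `λ = θ₂⁴/θ₃⁴`;
`ModularLambdaNome.lean`: `λ/16 = Λ(e^{πiτ})` with `Λ` holomorphic on the disc, `Λ'(0) = 1`).
We prove the classical derivative formula

* **`deriv_modularLambda_eq`**: `λ'(τ) = πi λ(τ) (1 − λ(τ)) θ₃(τ)⁴ = πi λ(τ) θ₄(τ)⁴` on `ℍ`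
  (Whittaker–Watson §21.7–21.71; equivalently `λ'/(λ(1−λ)) = πi θ₃⁴`, the weight-`2` form
  `θ₃⁴` on `Γ(2)`), hence
* **`deriv_modularLambda_ne_zero`**: `λ' ≠ 0` on `ℍ` — `λ : ℍ → ℂ ∖ {0,1}` is everywhere a local
  biholomorphism ("`Y(N) → Y(2)` finite étale" / `λ` unramified on `ℍ`, as `Γ(2)/±1` is
  torsion-free; [CalegariDimitrovTang2025, §3, proof of Proposition 15: "`f` is a regular function
  on some affine modular curve `Y` over `ℚ̄` which admits a finite étale map to `Y(2)`"]).

## Proof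

`r := λ'/(λ(1 − λ)θ₃⁴)` is a level-ONE modular function of weight `0`, holomorphic on `ℍ`: by the
chain rule `λ'(τ+1) = −λ'/(λ−1)²`, `λ'(−1/τ) = −τ²λ'` (from `λ(τ+1) = λ/(λ−1)`,
`λ(−1/τ) = 1 − λ`), while `θ₃(τ+1)⁴ = θ₄⁴ = (1−λ)θ₃⁴` and `θ₃(−1/τ)⁴ = −τ²θ₃⁴`; and `r → πi` at
`i∞`, because `λ = 16Λ(q)`, `q = e^{πiτ}`, gives `λ'/λ = πi · qΛ'(q)/Λ(q) → πi Λ'(0)/Λ'(0) = πi`.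
A holomorphic level-one weight-`0` form bounded at `i∞` is constant (Mathlib
`ModularFormClass.levelOne_weight_zero_const`), so `r ≡ πi`.

## References

* E. T. Whittaker, G. N. Watson, *A Course of Modern Analysis*, 4th ed. (1927), §21.7–21.71.
* [CalegariDimitrovTang2025] arXiv:2109.09040, §1 p. 3, §3 (Proposition 15: `Y → Y(2)` étale).
-/

noncomputable section

open Complex Real Filter Topology Function Metric Set
open UpperHalfPlane hiding I
open scoped Real Topology MatrixGroups

namespace Literature.NumberTheory.Automorphic

namespace ModularLambda

open Literature.NumberTheory.EllipticCurves.JacobiThetaNull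

/-! ### The derivative of `λ` under `T` and `S` -/

/-- `λ` has a derivative on `ℍ`. [folklore] -/
theorem hasDerivAt_modularLambda {τ : ℂ} (hτ : 0 < im τ) :
    HasDerivAt modularLambda (deriv modularLambda τ) τ :=
  (differentiableAt_modularLambda hτ).hasDerivAt

/-- **`λ'(τ + 1) = −λ'(τ)/(λ(τ) − 1)²`** (differentiate `λ(τ+1) = λ/(λ−1)`). [folklore] -/
theorem deriv_modularLambda_add_one {τ : ℂ} (hτ : 0 < im τ) :
    deriv modularLambda (τ + 1) = -deriv modularLambda τ / (modularLambda τ - 1) ^ 2 := by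
  have hτ1 : 0 < im (τ + 1) := by simpa using hτ
  have h1 : HasDerivAt (fun σ ↦ modularLambda (σ + 1)) (deriv modularLambda (τ + 1)) τ :=
    HasDerivAt.comp_add_const τ 1 (hasDerivAt_modularLambda hτ1)
  have hL := hasDerivAt_modularLambda hτ
  have hne : modularLambda τ - 1 ≠ 0 := sub_ne_zero.mpr (modularLambda_ne_one hτ)
  have h2 : HasDerivAt (fun σ ↦ modularLambda σ / (modularLambda σ - 1))
      ((deriv modularLambda τ * (modularLambda τ - 1) -
        modularLambda τ * deriv modularLambda τ) / (modularLambda τ - 1) ^ 2) τ :=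
    hL.div (hL.sub_const 1) hne
  have heq : (fun σ ↦ modularLambda (σ + 1)) =ᶠ[𝓝 τ]
      fun σ ↦ modularLambda σ / (modularLambda σ - 1) := by
    filter_upwards [(isOpen_lt continuous_const Complex.continuous_im).mem_nhds hτ] with σ hσ
    exact modularLambda_add_one hσ
  rw [h1.unique (h2.congr_of_eventuallyEq heq)]
  field_simp
  ring

/-- **`λ'(−1/τ) = −τ² λ'(τ)`** (differentiate `λ(−1/τ) = 1 − λ(τ)`). [folklore] -/
theorem deriv_modularLambda_neg_one_div {τ : ℂ} (hτ : 0 < im τ) :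
    deriv modularLambda (-1 / τ) = -τ ^ 2 * deriv modularLambda τ := by
  have hτ0 : τ ≠ 0 := ne_zero_of_im_pos hτ
  have hτ' : 0 < im (-1 / τ) := im_neg_one_div_pos hτ
  have e : ∀ σ : ℂ, -1 / σ = -σ⁻¹ := fun σ ↦ by rw [neg_div, one_div]
  have hm : HasDerivAt (fun σ : ℂ ↦ -1 / σ) ((τ ^ 2)⁻¹) τ := by
    have h := (hasDerivAt_inv hτ0).neg
    rw [neg_neg] at h
    refine h.congr_of_eventuallyEq (Eventually.of_forall fun σ ↦ ?_)
    exact e σ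
  have h1 : HasDerivAt (fun σ : ℂ ↦ modularLambda (-1 / σ))
      (deriv modularLambda (-1 / τ) * (τ ^ 2)⁻¹) τ :=
    (hasDerivAt_modularLambda hτ').comp τ hm
  have h2 : HasDerivAt (fun σ ↦ 1 - modularLambda σ) (-deriv modularLambda τ) τ :=
    (hasDerivAt_modularLambda hτ).const_sub 1
  have heq : (fun σ : ℂ ↦ modularLambda (-1 / σ)) =ᶠ[𝓝 τ] fun σ ↦ 1 - modularLambda σ := by
    filter_upwards [(isOpen_lt continuous_const Complex.continuous_im).mem_nhds hτ] with σ hσ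
    exact modularLambda_neg_one_div hσ
  have h3 := h1.unique (h2.congr_of_eventuallyEq heq)
  have hτ2 : τ ^ 2 ≠ 0 := pow_ne_zero 2 hτ0
  have h4 := congrArg (· * τ ^ 2) h3
  simp only [inv_mul_cancel_right₀ hτ2] at h4
  rw [h4]
  ring

/-- `θ₄⁴ = (1 − λ) θ₃⁴` on `ℍ`. [folklore] -/
theorem theta4_pow_four_eq {τ : ℂ} (hτ : 0 < im τ) :
    theta4 τ ^ 4 = (1 - modularLambda τ) * theta3 τ ^ 4 := by
  rw [one_sub_modularLambda hτ, div_mul_cancel₀ _ (pow_ne_zero 4 (theta3_ne_zero hτ))]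

/-! ### `r = λ'/(λ(1−λ)θ₃⁴)` is invariant under `T` and `S` -/

/-- `r(τ + 1) = r(τ)` for `r = λ'/(λ(1 − λ)θ₃⁴)`. [folklore] -/
theorem derivRatio_add_one {τ : ℂ} (hτ : 0 < im τ) :
    deriv modularLambda (τ + 1) /
        (modularLambda (τ + 1) * (1 - modularLambda (τ + 1)) * theta3 (τ + 1) ^ 4) =
      deriv modularLambda τ / (modularLambda τ * (1 - modularLambda τ) * theta3 τ ^ 4) := by
  have hl0 : modularLambda τ ≠ 0 := modularLambda_ne_zero hτ
  have hl1 : modularLambda τ - 1 ≠ 0 := sub_ne_zero.mpr (modularLambda_ne_one hτ)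
  have hl1' : 1 - modularLambda τ ≠ 0 := sub_ne_zero.mpr (modularLambda_ne_one hτ).symm
  have h3 : theta3 τ ≠ 0 := theta3_ne_zero hτ
  rw [deriv_modularLambda_add_one hτ, modularLambda_add_one hτ, theta3_add_one,
    theta4_pow_four_eq hτ]
  field_simp
  ring

/-- `r(−1/τ) = r(τ)` for `r = λ'/(λ(1 − λ)θ₃⁴)`. [folklore] -/
theorem derivRatio_neg_one_div {τ : ℂ} (hτ : 0 < im τ) :
    deriv modularLambda (-1 / τ) /
        (modularLambda (-1 / τ) * (1 - modularLambda (-1 / τ)) * theta3 (-1 / τ) ^ 4) =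
      deriv modularLambda τ / (modularLambda τ * (1 - modularLambda τ) * theta3 τ ^ 4) := by
  have hτ0 : τ ≠ 0 := ne_zero_of_im_pos hτ
  have hl0 : modularLambda τ ≠ 0 := modularLambda_ne_zero hτ
  have hl1' : 1 - modularLambda τ ≠ 0 := sub_ne_zero.mpr (modularLambda_ne_one hτ).symm
  have h3 : theta3 τ ≠ 0 := theta3_ne_zero hτ
  have hτ2 : -τ ^ 2 ≠ 0 := neg_ne_zero.mpr (pow_ne_zero 2 hτ0)
  rw [deriv_modularLambda_neg_one_div hτ, modularLambda_neg_one_div hτ, theta3_neg_one_div hτ,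
    mul_pow, cpow_half_pow_four, sub_sub_cancel,
    div_eq_div_iff (mul_ne_zero (mul_ne_zero hl1' hl0) (mul_ne_zero hτ2 (pow_ne_zero 4 h3)))
      (mul_ne_zero (mul_ne_zero hl0 hl1') (pow_ne_zero 4 h3))]
  ring

/-! ### The limit `λ'/λ → πi` at `i∞` -/

/-- **`λ' = 16 Λ'(q) · πi q`**, `q = e^{πiτ}`, `Λ` the cusp function of `λ/16` (chain rule on
`λ(τ) = 16 Λ(e^{πiτ})`). [folklore] -/
theorem deriv_modularLambda_eq_cuspFunction {τ : ℂ} (hτ : 0 < im τ) :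
    deriv modularLambda τ =
      16 * deriv (cuspFunction 2 (fun τ : ℍ ↦ modularLambda τ / 16)) (cexp (π * I * τ)) *
        (π * I * cexp (π * I * τ)) := by
  set Λ := cuspFunction 2 (fun τ : ℍ ↦ modularLambda τ / 16) with hΛ
  have hq : ‖cexp (π * I * τ)‖ < 1 := by
    rw [← qParam_two]
    exact Periodic.norm_qParam_lt_one two_pos hτ
  have hΛd : DifferentiableAt ℂ Λ (cexp (π * I * τ)) :=
    differentiableOn_cuspFunction_modularLambda.differentiableAt
      (isOpen_ball.mem_nhds (mem_ball_zero_iff.mpr hq))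
  have hlin : HasDerivAt (fun σ : ℂ ↦ π * I * σ) (π * I) τ := by
    simpa using (hasDerivAt_id τ).const_mul (π * I)
  have hexp : HasDerivAt (fun σ : ℂ ↦ cexp (π * I * σ)) (cexp (π * I * τ) * (π * I)) τ :=
    hlin.cexp
  have hcomp : HasDerivAt (fun σ : ℂ ↦ 16 * Λ (cexp (π * I * σ)))
      (16 * (deriv Λ (cexp (π * I * τ)) * (cexp (π * I * τ) * (π * I)))) τ :=
    (hΛd.hasDerivAt.comp τ hexp).const_mul 16
  have heq : (fun σ : ℂ ↦ 16 * Λ (cexp (π * I * σ))) =ᶠ[𝓝 τ] modularLambda := by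
    filter_upwards [(isOpen_lt continuous_const Complex.continuous_im).mem_nhds hτ] with σ hσ
    rw [hΛ, cuspFunction_modularLambda_exp hσ]
    ring
  rw [(hcomp.congr_of_eventuallyEq heq.symm).deriv]
  ring

/-- `e^{πiτ} → 0` at `i∞`, within `{0}ᶜ`. [folklore] -/
theorem tendsto_exp_pi_I_nhdsWithin :
    Tendsto (fun τ : ℂ ↦ cexp (π * I * τ)) (comap im atTop) (𝓝[≠] 0) := by
  have h0 : Tendsto (fun τ : ℂ ↦ cexp (π * I * τ)) (comap im atTop) (𝓝 0) := by
    have h := tendsto_exp_quarter.pow 4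
    rw [zero_pow (by norm_num)] at h
    refine h.congr fun τ ↦ ?_
    rw [← Complex.exp_nat_mul]
    congr 1
    push_cast
    ring
  exact tendsto_nhdsWithin_iff.mpr ⟨h0, Eventually.of_forall fun τ ↦ exp_ne_zero _⟩

/-- **`λ'/λ → πi` at `i∞`** (`λ ∼ 16q`, `λ' ∼ 16πi q`). [folklore] -/
theorem tendsto_deriv_div_modularLambda :
    Tendsto (fun τ : ℂ ↦ deriv modularLambda τ / modularLambda τ) (comap im atTop)
      (𝓝 (π * I)) := by
  set Λ := cuspFunction 2 (fun τ : ℍ ↦ modularLambda τ / 16) with hΛ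
  have hΛzero : Λ 0 = 0 := cuspFunction_modularLambda_zero
  have hΛd1 : deriv Λ 0 = 1 := deriv_cuspFunction_modularLambda_zero
  -- `Λ'(q) → 1` and `Λ(q)/q → 1` as `q → 0`
  have hΛ0 : DifferentiableAt ℂ Λ 0 :=
    differentiableOn_cuspFunction_modularLambda.differentiableAt (ball_mem_nhds 0 one_pos)
  have hderiv : Tendsto (deriv Λ) (𝓝 0) (𝓝 1) := by
    have han : AnalyticAt ℂ Λ 0 :=
      differentiableOn_cuspFunction_modularLambda.analyticAt (ball_mem_nhds 0 one_pos)
    have h := han.deriv.continuousAt.tendsto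
    rwa [hΛd1] at h
  have hdslope : Tendsto (dslope Λ 0) (𝓝 0) (𝓝 1) := by
    have h := (continuousAt_dslope_same.mpr hΛ0).tendsto
    rwa [dslope_same, hΛd1] at h
  have hF : Tendsto (fun q ↦ q * deriv Λ q / Λ q) (𝓝[≠] 0) (𝓝 1) := by
    have h := (hderiv.div hdslope one_ne_zero).mono_left (nhdsWithin_le_nhds (s := {(0 : ℂ)}ᶜ))
    rw [div_one] at h
    refine h.congr' (eventually_nhdsWithin_of_forall fun q hq ↦ ?_)
    have hq : q ≠ 0 := hq
    simp only [Pi.div_apply]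
    rw [dslope_of_ne _ hq, slope_def_field, hΛzero, sub_zero, sub_zero]
    field_simp
  -- compose with `q = e^{πiτ} → 0`
  have hcomp := hF.comp tendsto_exp_pi_I_nhdsWithin
  have him : ∀ᶠ τ : ℂ in comap im atTop, 0 < im τ := by
    filter_upwards [preimage_mem_comap (Ioi_mem_atTop (0 : ℝ))] with τ hτ using hτ
  have h := hcomp.const_mul (π * I)
  rw [mul_one] at h
  refine Tendsto.congr' ?_ h
  filter_upwards [him] with τ hτ
  simp only [comp_apply]
  have hq1 : ‖cexp (π * I * τ)‖ < 1 := by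
    rw [← qParam_two]
    exact Periodic.norm_qParam_lt_one two_pos hτ
  have hΛne : Λ (cexp (π * I * τ)) ≠ 0 := cuspFunction_modularLambda_ne_zero hq1 (exp_ne_zero _)
  have hlam : modularLambda τ = 16 * Λ (cexp (π * I * τ)) := by
    have e : Λ (cexp (π * I * τ)) = modularLambda τ / 16 := cuspFunction_modularLambda_exp hτ
    rw [e]
    ring
  rw [deriv_modularLambda_eq_cuspFunction hτ, hlam]
  show π * I * (cexp (π * I * τ) * deriv Λ (cexp (π * I * τ)) / Λ (cexp (π * I * τ))) =
    16 * deriv Λ (cexp (π * I * τ)) * (π * I * cexp (π * I * τ)) / (16 * Λ (cexp (π * I * τ)))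
  field_simp

/-- `r = λ'/(λ(1−λ)θ₃⁴) → πi` at `i∞`. [folklore] -/
theorem tendsto_derivRatio :
    Tendsto (fun τ : ℂ ↦ deriv modularLambda τ /
      (modularLambda τ * (1 - modularLambda τ) * theta3 τ ^ 4)) (comap im atTop) (𝓝 (π * I)) := by
  have h1 : Tendsto (fun τ : ℂ ↦ 1 - modularLambda τ) (comap im atTop) (𝓝 1) := by
    have h := tendsto_modularLambda.const_sub 1
    rwa [sub_zero] at h
  have h := tendsto_deriv_div_modularLambda.div (h1.mul (tendsto_theta3.pow 4)) (by norm_num)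
  rw [one_pow, mul_one, div_one] at h
  refine h.congr fun τ ↦ ?_
  simp only [Pi.div_apply]
  rw [div_div, mul_assoc]

/-! ### `r` is a holomorphic level-one modular function of weight `0`, hence constant -/

/-- `λ'` is holomorphic on `ℍ`. [folklore] -/
theorem differentiableAt_deriv_modularLambda {τ : ℂ} (hτ : 0 < im τ) :
    DifferentiableAt ℂ (deriv modularLambda) τ := by
  have hopen : IsOpen {z : ℂ | 0 < z.im} := isOpen_lt continuous_const Complex.continuous_im
  have han : AnalyticOnNhd ℂ modularLambda {z : ℂ | 0 < z.im} :=
    DifferentiableOn.analyticOnNhd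
      (fun z hz ↦ (differentiableAt_modularLambda hz).differentiableWithinAt) hopen
  exact (han.deriv τ hτ).differentiableAt

section LevelOne

open ModularForm SlashInvariantForm CongruenceSubgroup

open scoped ModularForm

/-- **`λ'/(λ(1 − λ)θ₃⁴) ≡ πi` on `ℍ`**: the ratio is a holomorphic level-one modular function of
weight `0`, bounded at `i∞` (where it tends to `πi`), hence constant (Mathlib
`levelOne_weight_zero_const`). [folklore] -/
theorem derivRatio_eq_pi_I {τ : ℂ} (hτ : 0 < im τ) :
    deriv modularLambda τ / (modularLambda τ * (1 - modularLambda τ) * theta3 τ ^ 4) = π * I := by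
  set g : ℂ → ℂ := fun τ ↦ deriv modularLambda τ /
    (modularLambda τ * (1 - modularLambda τ) * theta3 τ ^ 4) with hg
  have hT : ∀ τ : ℂ, 0 < im τ → g (τ + 1) = g τ := fun τ hτ ↦ derivRatio_add_one hτ
  have hS : ∀ τ : ℂ, 0 < im τ → g (-1 / τ) = g τ := fun τ hτ ↦ derivRatio_neg_one_div hτ
  have hhol : ∀ τ : ℂ, 0 < im τ → DifferentiableAt ℂ g τ := fun τ hτ ↦
    (differentiableAt_deriv_modularLambda hτ).div
      (((differentiableAt_modularLambda hτ).mul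
        ((differentiableAt_const 1).sub (differentiableAt_modularLambda hτ))).mul
        ((differentiableAt_theta3 hτ).pow 4))
      (mul_ne_zero (mul_ne_zero (modularLambda_ne_zero hτ)
        (sub_ne_zero.mpr (modularLambda_ne_one hτ).symm)) (pow_ne_zero 4 (theta3_ne_zero hτ)))
  have hlim : Tendsto g (comap im atTop) (𝓝 (π * I)) := tendsto_derivRatio
  -- slash invariance under the generators (weight 0)
  have hS' : (fun τ : ℍ ↦ g τ) ∣[(0 : ℤ)] ModularGroup.S = fun τ : ℍ ↦ g τ := by
    ext z
    rw [slash_S_apply]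
    have hz : 0 < im (z : ℂ) := z.2
    change g (-(z : ℂ))⁻¹ * (z : ℂ) ^ (-(0 : ℤ)) = g z
    rw [inv_neg, ← one_div, ← neg_div, hS z hz, neg_zero, zpow_zero, mul_one]
  have hT' : (fun τ : ℍ ↦ g τ) ∣[(0 : ℤ)] ModularGroup.T = fun τ : ℍ ↦ g τ := by
    ext z
    rw [SL_slash_apply, modular_T_smul, UpperHalfPlane.coe_vadd]
    simp only [ModularGroup.T, denom]
    push_cast
    rw [add_comm, hT z z.2]
    simp
  have hgen := slash_action_generators_SL2Z hS' hT'
  let F : ModularForm 𝒮ℒ 0 :=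
    { toFun := fun τ ↦ g τ
      slash_action_eq' := fun A hA ↦ by
        obtain ⟨A, rfl⟩ := hA
        exact hgen A
      holo' := by
        rw [UpperHalfPlane.mdifferentiable_iff]
        have h1 : DifferentiableOn ℂ g {z : ℂ | 0 < z.im} :=
          fun z hz ↦ (hhol z hz).differentiableWithinAt
        refine h1.congr fun z hz ↦ ?_
        simp [ofComplex_apply_of_im_pos hz]
      bdd_at_cusps' := fun hc ↦ by
        rw [Subgroup.IsArithmetic.isCusp_iff_isCusp_SL2Z] at hc
        rw [OnePoint.isBoundedAt_iff_forall_SL2Z hc]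
        intro γ _
        rw [hgen γ]
        exact (hlim.comp tendsto_coe_atImInfty).isBigO_one ℝ }
  obtain ⟨c, hc⟩ := ModularFormClass.levelOne_weight_zero_const F
  have hcτ : ∀ z : ℍ, g z = c := fun z ↦ by
    have := congrFun hc z
    exact this
  -- the constant is `πi`
  have hconst : Tendsto (fun z : ℍ ↦ g z) atImInfty (𝓝 c) := by
    simp only [hcτ]
    exact tendsto_const_nhds
  have hc' : c = π * I := tendsto_nhds_unique hconst (hlim.comp tendsto_coe_atImInfty)
  show g τ = π * I
  rw [show g τ = g ((⟨τ, hτ⟩ : ℍ) : ℂ) from rfl, hcτ, hc']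

end LevelOne

/-! ### The derivative formula and `λ' ≠ 0` -/

/-- **`λ'(τ) = πi · λ(τ) (1 − λ(τ)) θ₃(τ)⁴`** on `ℍ` (i.e. `λ'/(λ(1−λ)) = πi θ₃⁴`). [folklore] -/
theorem deriv_modularLambda_eq {τ : ℂ} (hτ : 0 < im τ) :
    deriv modularLambda τ =
      π * I * modularLambda τ * (1 - modularLambda τ) * theta3 τ ^ 4 := by
  have h := derivRatio_eq_pi_I hτ
  have hne : modularLambda τ * (1 - modularLambda τ) * theta3 τ ^ 4 ≠ 0 :=
    mul_ne_zero (mul_ne_zero (modularLambda_ne_zero hτ)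
      (sub_ne_zero.mpr (modularLambda_ne_one hτ).symm)) (pow_ne_zero 4 (theta3_ne_zero hτ))
  rw [div_eq_iff hne] at h
  rw [h]
  ring

/-- **`λ'(τ) = πi · λ(τ) · θ₄(τ)⁴`** (`θ₄⁴ = (1−λ)θ₃⁴`; Whittaker–Watson §21.71). [folklore] -/
theorem deriv_modularLambda_eq' {τ : ℂ} (hτ : 0 < im τ) :
    deriv modularLambda τ = π * I * modularLambda τ * theta4 τ ^ 4 := by
  rw [deriv_modularLambda_eq hτ, theta4_pow_four_eq hτ]
  ring

/-- **`λ` has no critical points on `ℍ`: `λ'(τ) ≠ 0`** — `λ : ℍ → ℂ ∖ {0, 1}` is a local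
biholomorphism everywhere (`Y(2)` is uniformized without ramification; cf.
[CalegariDimitrovTang2025, §3 proof of Proposition 15]). [folklore] -/
theorem deriv_modularLambda_ne_zero {τ : ℂ} (hτ : 0 < im τ) : deriv modularLambda τ ≠ 0 := by
  rw [deriv_modularLambda_eq' hτ]
  exact mul_ne_zero (mul_ne_zero (mul_ne_zero (ofReal_ne_zero.mpr pi_ne_zero) I_ne_zero)
    (modularLambda_ne_zero hτ)) (pow_ne_zero 4 (theta4_ne_zero hτ))

end ModularLambda

end Literature.NumberTheory.Automorphic

end
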